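import Literature.MathematicalPhysics.QuantumFieldTheory.Balaban1983to89.Beta.PlaquetteVertex2Stencil

/-!
# COLOUR ⊗ COLOURLESS: the first-order Wilson vertex is `A ⊗ W₀`; against colour-blind legs its bubble and its tadpole carry the
# single colour weights `trace (A·A′)` and `trace A`

HONEST FRAMING (cell `pub-balaban`, β sub-cell, lineage an3; verbatim): discharging `BetaPertH` makes Bałaban's UV stability
UNCONDITIONAL — a real constructive-QFT result; it is NOT the continuum limit and NOT the Clay problem.  This file discharges NOTHING
of `BetaPertH`.  It is the FIRST-ORDER companion of `Beta.PlaquetteVertex2Words` (which un-pre-sums the second-order plaquette kernel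
into nine colour words): the colour-generic one-bond Wilson vertex `PlaquetteStencil.wilsonVertex₁ e z γ A` (the exact `B`-linear
`W`-Hessian vertex of the Wilson action, headline `PlaquetteStencil.actionJet21_eq_wilsonVertex₁`; stencil format
`PlaquetteStencilData.wilsonVertex₁_eq_stencil`) has ONE colour word — every one of its colour blocks is `A ⊗ N_s` with a COLOURLESS
direction block `N_s` — and this file says so in the kernel and draws the two consequences a colour-blind contraction needs.

ABSOLUTE RULE (cell charter, verbatim in substance): no internally-minted statement enters as a cited fact; every hypothesis of every
theorem below is kernel-proved in this package; NOTHING is cited; B9/B12 appear only as CONTEXT.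

WHAT IS KERNEL-CHECKED.
* §1 KRONECKER FORMS: `dirBlock α β A = A ⊗ₖ e_{αβ}` (`dirBlock_eq_kronecker`), the colour-blind leg `cbLeg G z = 1_C ⊗ₖ G z`
  (`cbLeg_eq_kronecker`), and the two trace factorisations `trace ((1 ⊗ G₁)(A ⊗ N)) = trace A · trace (G₁N)`,
  `trace ((1 ⊗ G₁)(A ⊗ N)(1 ⊗ G₂)(A′ ⊗ N′)) = trace (AA′) · trace (G₁ N G₂ N′)` (`trace_kronLeg_mul`, `trace_kronLeg_mul_kronLeg_mul`;
  Mathlib's `Matrix.mul_kronecker_mul`, `Matrix.trace_kronecker`).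
* §2 THE COLOURLESS BLOCK DATA `wn γ : WilsonIdx D → Matrix D D ℝ` (the twin of `PlaquetteStencilData.wm γ A` with every `dirBlock α β A`
  replaced by `e_{αβ}`, `copies D A` by `1_D`, `spinMat β γ A` by `spinDir β γ`, all signs and scalars `sTot, 2, −½` kept) and
  **`wm_eq_kronecker : wm γ A = fun s ↦ A ⊗ₖ wn γ s`** — component by component (`curM_copies_eq_kronecker`, `spM_eq_kronecker`,
  `dvm_eq_kronecker`, `fam_/trm_/dim_/bsm_/rmm_eq_kronecker`).
* §3 THE COLOURLESS WILSON STENCIL `wilsonStencil₀ e z γ := stencilIns z univ (wα e γ) (wβ e γ) (wn γ)` on `Λ × D` and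
  **`wilsonVertex₁_eq_kronStencil : wilsonVertex₁ e z γ A = stencilIns z univ (wα e γ) (wβ e γ) (fun s ↦ A ⊗ₖ wn γ s)`**;
  ENTRYWISE **`wilsonVertex₁_apply_eq_mul : wilsonVertex₁ e z γ A (x,(a,α)) (y,(b,β)) = A a b · wilsonStencil₀ e z γ (x,α) (y,β)`**;
  and **`wilsonStencil₀_apply_eq_unit`**: the colourless stencil IS the vertex read at the colourless instance `C := Unit, A := 1` —
  `wilsonStencil₀ e z γ (x,α) (y,β) = wilsonVertex₁ (C := Unit) e z γ 1 (x,((),α)) (y,((),β))` (the reading an2's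
  `StepJetData.wEntry` takes on `ℤ^{d+1}`), so **`wilsonVertex₁_apply_eq_mul_unit`**: `wilsonVertex₁ e z γ A (x,(a,α)) (y,(b,β)) =
  A a b · wilsonVertex₁ (C := Unit) e z γ 1 (x,((),α)) (y,((),β))` — AT FIRST ORDER THE `A := 1` COLOUR STRIPPING LOSES NOTHING.
* §4 COLOUR-BLIND CONTRACTIONS (translation-invariant legs `mconvKernel (cbLeg G)`, `BubbleTable` by name):
  **`wilsonBubble_colourBlind : trace (mconvKernel (cbLeg G) · wilsonVertex₁ e z γ A · (mconvKernel (cbLeg G′) · wilsonVertex₁ e (z+w) γ′ A′))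
     = trace (A·A′) · trace (mconvKernel G · wilsonStencil₀ e z γ · (mconvKernel G′ · wilsonStencil₀ e (z+w) γ′))`** (+ its finite
  table over `WilsonIdx D × WilsonIdx D`, `_table`, and base-point independence of the colourless bubble, `wilsonBubble₀_translate`);
  **`wilsonTadpole_colourBlind : trace (mconvKernel (cbLeg G) · wilsonVertex₁ e z γ A) = trace A · trace (mconvKernel G · wilsonStencil₀ e z γ)`**
  (+ `_table`), hence `= 0` for traceless `A` (`_eq_zero`), in particular for every `adM τ t F` (`trace_adM`: `adM` is antisymmetric,
  `PlaquetteVertex.adM_antisymm`) — `wilsonTadpole_adM`; and in Bałaban's letters (`A = adM rntr (gen τ) (gen τ c) = adMat τ (τ c)`,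
  `PlaquetteVertex.adM_gen`; weight `ColourTrace.trace_adMat_gen` BY NAME) **`wilsonBubble_gen`**: the colour-blind Wilson bubble between
  background letters `gen τ c` at `(z,γ)` and `gen τ c′` at `(z+w,γ′)` is `[c = c′]·(−2N²)` times the colourless bubble.

READING FOR THE CELL (an2-g8's colour-stripping convention F-an2g8-1 (F2), journal l.54170: «the TRUE first-order background vertex in
colour direction c is S ⊗ ad t_c … the packed resolvent is colour-blind, so bubble (KInv ⊗ 1)(S ⊗ ad t_c)(S′ ⊗ ad t_c′) = bubble KInv S S′ ·
tr_C(ad t_c ad t_c′) — ONE real weight»).  For the WILSON-ACTION first-order vertex this design is here a theorem on an3's side: `S` is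
`wilsonStencil₀` (= an2's `C := Unit, A := 1` reading, `wilsonStencil₀_apply_eq_unit`), the factorisation is `wilsonBubble_colourBlind`
for ANY colour matrices and ANY matrix-valued translation-invariant colour-blind legs on ANY torus, and the one real weight in Bałaban's
letters is `−2N²·[c=c′]` (`wilsonBubble_gen`).  The second-order (tadpole) companion with its NINE words is `Beta.PlaquetteVertex2Words` /
`PlaquetteVertex2Stencil.contact_P22Mat_colourBlind`.

NOT PROVED, NOT CLAIMED: anything about an2's packed fibre, multiplier legs, `KInv`, localisation or rates (an2's lane: this file is on a
finite torus with abstract legs `G`); any value of a propagator, of a bubble, of a β-function coefficient (NO comparison with `11N/3`);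
gauge fixing/averaging; `BetaPertH`, UV stability, continuum limit, Clay.  Identity-level bookkeeping; no numerics.
-/

namespace Literature.MathematicalPhysics.QuantumFieldTheory.Balaban1983to89.Beta.WilsonVertexKron

open Finset
open scoped BigOperators Matrix Kronecker
open Literature.MathematicalPhysics.QuantumFieldTheory.Balaban1983to89.Beta.BubbleTable (stencilIns mconvKernel
  bubble_stencil_eq_table_m contact_stencil_m)
open Literature.MathematicalPhysics.QuantumFieldTheory.Balaban1983to89.Beta.GhostTable (copies curM)
open Literature.MathematicalPhysics.QuantumFieldTheory.Balaban1983to89.Beta.SpinTable (spinDir spinMat spM copies_eq_kronecker)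
open Literature.MathematicalPhysics.QuantumFieldTheory.Balaban1983to89.Beta.PlaquetteWeitzenbock (sTot)
open Literature.MathematicalPhysics.QuantumFieldTheory.Balaban1983to89.Beta.PlaquetteStencil (dirBlock dirBlock_apply wilsonVertex₁)
open Literature.MathematicalPhysics.QuantumFieldTheory.Balaban1983to89.Beta.PlaquetteStencilData (WilsonIdx RemIdx wα wβ wm dvm fam
  trm dim bsm rmm bsgn bd₁ bd₂ stencilIns_apply wilsonVertex₁_eq_stencil)
open Literature.MathematicalPhysics.QuantumFieldTheory.Balaban1983to89.Beta.PlaquetteVertex2Stencil (cbLeg)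
open Literature.MathematicalPhysics.QuantumFieldTheory.Balaban1983to89.Beta.ColourTrace (Complete TrOrthonormal adMat trace_adMat_gen)
open Literature.MathematicalPhysics.QuantumFieldTheory.Balaban1983to89.Beta.PlaquetteVertex (rntr gen adM adM_antisymm adM_gen)

/-! ## §1 Kronecker forms of the direction block and of the colour-blind leg; the two trace factorisations -/

section Kron

variable {C : Type*} {D : Type*}

/-- `A ⊗ₖ (−N) = −(A ⊗ₖ N)`. [folklore] -/
theorem kron_neg (A : Matrix C C ℝ) (N : Matrix D D ℝ) : A ⊗ₖ (-N) = -(A ⊗ₖ N) := by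
  ext ⟨a, k⟩ ⟨b, k'⟩
  simp only [Matrix.kronecker_apply, Matrix.neg_apply, mul_neg]

/-- `A ⊗ₖ (2·e_{αβ}) = 2 • (A ⊗ₖ e_{αβ})` (the form `simp` produces from `2 • e_{αβ}`). [folklore] -/
theorem kron_single_two [DecidableEq D] (A : Matrix C C ℝ) (α β : D) :
    A ⊗ₖ Matrix.single α β (2 : ℝ) = (2 : ℝ) • (A ⊗ₖ Matrix.single α β 1) := by
  ext ⟨a, k⟩ ⟨b, k'⟩
  simp only [Matrix.kronecker_apply, Matrix.smul_apply, Matrix.single_apply, smul_eq_mul]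
  split_ifs <;> ring

/-- **THE DIRECTION BLOCK IS A KRONECKER PRODUCT**: `dirBlock α β A = A ⊗ₖ e_{αβ}` (`e_{αβ} = Matrix.single α β 1`). [folklore] -/
theorem dirBlock_eq_kronecker [DecidableEq D] (α β : D) (A : Matrix C C ℝ) :
    dirBlock α β A = A ⊗ₖ Matrix.single α β (1 : ℝ) := by
  ext ⟨a, k⟩ ⟨b, k'⟩
  simp only [dirBlock_apply, Matrix.kronecker_apply, Matrix.single_apply, mul_ite, mul_one, mul_zero, @eq_comm _ k α,
    @eq_comm _ k' β]

/-- **THE COLOUR-BLIND LEG IS A KRONECKER PRODUCT**: `cbLeg G z = 1_C ⊗ₖ G z`. [folklore] -/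
theorem cbLeg_eq_kronecker {Λ : Type*} [DecidableEq C] (G : Λ → Matrix D D ℝ) (z : Λ) :
    cbLeg (C := C) G z = (1 : Matrix C C ℝ) ⊗ₖ G z := by
  ext ⟨a, k⟩ ⟨b, k'⟩
  simp only [cbLeg, Matrix.of_apply, Matrix.kronecker_apply, Matrix.one_apply, ite_mul, one_mul, zero_mul]

/-- CONTACT FACTORISATION: `trace ((1 ⊗ G₁) · (A ⊗ N)) = trace A · trace (G₁ · N)`. [folklore] -/
theorem trace_kronLeg_mul [Fintype C] [DecidableEq C] [Fintype D] (G₁ : Matrix D D ℝ) (A : Matrix C C ℝ) (N : Matrix D D ℝ) :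
    Matrix.trace ((1 : Matrix C C ℝ) ⊗ₖ G₁ * (A ⊗ₖ N)) = Matrix.trace A * Matrix.trace (G₁ * N) := by
  rw [← Matrix.mul_kronecker_mul, Matrix.trace_kronecker, one_mul]

/-- BUBBLE FACTORISATION: `trace ((1 ⊗ G₁) · (A ⊗ N) · ((1 ⊗ G₂) · (A′ ⊗ N′))) = trace (A·A′) · trace (G₁ · N · (G₂ · N′))`. [folklore] -/
theorem trace_kronLeg_mul_kronLeg_mul [Fintype C] [DecidableEq C] [Fintype D] (G₁ G₂ : Matrix D D ℝ) (A A' : Matrix C C ℝ)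
    (N N' : Matrix D D ℝ) :
    Matrix.trace ((1 : Matrix C C ℝ) ⊗ₖ G₁ * (A ⊗ₖ N) * ((1 : Matrix C C ℝ) ⊗ₖ G₂ * (A' ⊗ₖ N'))) =
      Matrix.trace (A * A') * Matrix.trace (G₁ * N * (G₂ * N')) := by
  rw [← Matrix.mul_kronecker_mul, ← Matrix.mul_kronecker_mul, ← Matrix.mul_kronecker_mul, Matrix.trace_kronecker, one_mul, one_mul]

end Kron

/-! ## §2 The colourless block data of the Wilson first-order vertex and `wm γ A = A ⊗ wn γ` -/

section Colourless

variable {C : Type*} {D : Type*} [DecidableEq D]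

/-- colourless twin of `curM (copies D A)`: `1_D`, `−1_D`.  A definition asserting nothing. [folklore] -/
def curN : Bool → Matrix D D ℝ := fun b => if b then 1 else -1

/-- colourless twin of `spM γ A`: `± spinDir β γ`.  A definition asserting nothing. [folklore] -/
def spN (γ : D) : D × Bool → Matrix D D ℝ := fun s => (if s.2 then (1 : ℝ) else -1) • spinDir s.1 γ

/-- colourless twin of `dvm γ A`: `± e_{γμ}`.  A definition asserting nothing. [folklore] -/
def dvn (γ : D) : D × Bool → Matrix D D ℝ := fun p => if p.2 then Matrix.single γ p.1 1 else -Matrix.single γ p.1 1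

/-- colourless twin of `fam α β A`: `± e_{αβ}`.  A definition asserting nothing. [folklore] -/
def fan (α β : D) : Bool → Matrix D D ℝ := fun b => if b then Matrix.single α β 1 else -Matrix.single α β 1

/-- colourless twin of `trm α β A` (the transport insertion's eight blocks).  A definition asserting nothing. [folklore] -/
def trn (α β : D) : Fin 8 → Matrix D D ℝ :=
  ![Matrix.single α β 1, -Matrix.single α β 1, -Matrix.single α α 1, Matrix.single α α 1, Matrix.single β β 1,
    -Matrix.single β β 1, -Matrix.single β α 1, Matrix.single β α 1]

/-- colourless twin of `dim α β A` (the difference insertion's twelve blocks).  A definition asserting nothing. [folklore] -/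
def din (α β : D) : Fin 12 → Matrix D D ℝ :=
  ![(2 : ℝ) • Matrix.single α β 1, -((2 : ℝ) • Matrix.single α β 1), -((2 : ℝ) • Matrix.single β α 1), (2 : ℝ) • Matrix.single β α 1,
    -Matrix.single α α 1, Matrix.single α α 1, Matrix.single β β 1, -Matrix.single β β 1,
    -Matrix.single β α 1, Matrix.single β α 1, Matrix.single β α 1, -Matrix.single β α 1]

omit [DecidableEq D] in
/-- colourless twin of `bsm γ km` (one-bond sum of a based family: the reading's sign times the family's colourless block).  A definition
asserting nothing. [folklore] -/
def bsn {σ : Type*} (γ : D) (kn : D → D → σ → Matrix D D ℝ) : D × (Fin 4 × σ) → Matrix D D ℝ :=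
  fun p => bsgn p.2.1 • kn (bd₁ p.1 γ p.2.1) (bd₂ p.1 γ p.2.1) p.2.2

/-- colourless twin of `rmm γ A` (the remainder vertex's blocks: `−½`, `+1`, `−1` times the three families).  A definition asserting
nothing. [folklore] -/
noncomputable def rmn (γ : D) : RemIdx D → Matrix D D ℝ :=
  Sum.elim (Sum.elim (-((2 : ℝ)⁻¹ • bsn γ din)) (bsn γ trn)) (-bsn γ fan)

/-- **THE COLOURLESS BLOCK DATA OF THE WILSON FIRST-ORDER VERTEX** `wn γ : WilsonIdx D → Matrix D D ℝ`: the twin of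
`PlaquetteStencilData.wm γ A` with `copies D A ↦ 1_D`, `spinMat β γ A ↦ spinDir β γ`, `dirBlock α β A ↦ e_{αβ}`, all signs and the
scalars `sTot`, `2`, `−½` kept.  A definition asserting nothing. [folklore] -/
noncomputable def wn (γ : D) : WilsonIdx D → Matrix D D ℝ :=
  Sum.elim (Sum.elim (Sum.elim curN (sTot • spN γ)) ((2 : ℝ) • dvn γ)) (rmn γ)

/-- the current's blocks: `curM (copies D A) b = A ⊗ₖ curN b`. [folklore] -/
theorem curM_copies_eq_kronecker (A : Matrix C C ℝ) (b : Bool) : curM (copies D A) b = A ⊗ₖ curN b := by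
  cases b <;> simp [curM, curN, copies_eq_kronecker, kron_neg]

/-- the spin vertex's blocks: `(sTot • spM γ A) s = A ⊗ₖ (sTot • spN γ) s`. [folklore] -/
theorem spM_eq_kronecker (γ : D) (A : Matrix C C ℝ) (s : D × Bool) : (sTot • spM γ A) s = A ⊗ₖ (sTot • spN γ) s := by
  simp only [Pi.smul_apply, spM, spN, spinMat, Matrix.kronecker_smul]

/-- the longitudinal vertex's blocks: `((2:ℝ) • dvm γ A) p = A ⊗ₖ ((2:ℝ) • dvn γ) p`. [folklore] -/
theorem dvm_eq_kronecker (γ : D) (A : Matrix C C ℝ) (p : D × Bool) : ((2 : ℝ) • dvm γ A) p = A ⊗ₖ ((2 : ℝ) • dvn γ) p := by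
  obtain ⟨μ, b⟩ := p
  cases b <;> simp [dvm, dvn, dirBlock_eq_kronecker, kron_neg, kron_single_two]

/-- the far-corner family's blocks. [folklore] -/
theorem fam_eq_kronecker (α β : D) (A : Matrix C C ℝ) (b : Bool) : fam α β A b = A ⊗ₖ fan α β b := by
  cases b <;> simp [fam, fan, dirBlock_eq_kronecker, kron_neg]

/-- the transport family's blocks. [folklore] -/
theorem trm_eq_kronecker (α β : D) (A : Matrix C C ℝ) (i : Fin 8) : trm α β A i = A ⊗ₖ trn α β i := by
  fin_cases i <;> simp [trm, trn, dirBlock_eq_kronecker, kron_neg]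

/-- the difference family's blocks. [folklore] -/
theorem dim_eq_kronecker (α β : D) (A : Matrix C C ℝ) (i : Fin 12) : dim α β A i = A ⊗ₖ din α β i := by
  fin_cases i <;> simp [dim, din, dirBlock_eq_kronecker, kron_neg, kron_single_two]

omit [DecidableEq D] in
/-- one-bond sums: if the family's blocks are `A ⊗ kn`, so are the summed blocks. [folklore] -/
theorem bsm_eq_kronecker {σ : Type*} (γ : D) (A : Matrix C C ℝ) (km : D → D → σ → Matrix (C × D) (C × D) ℝ)
    (kn : D → D → σ → Matrix D D ℝ) (hk : ∀ α β s, km α β s = A ⊗ₖ kn α β s) (p : D × (Fin 4 × σ)) :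
    bsm γ km p = A ⊗ₖ bsn γ kn p := by
  simp only [bsm, bsn, hk, Matrix.kronecker_smul]

/-- the remainder vertex's blocks: `rmm γ A i = A ⊗ₖ rmn γ i`. [folklore] -/
theorem rmm_eq_kronecker (γ : D) (A : Matrix C C ℝ) (i : RemIdx D) : rmm γ A i = A ⊗ₖ rmn γ i := by
  rcases i with (p | p) | p
  · simp only [rmm, rmn, Sum.elim_inl, Pi.neg_apply, Pi.smul_apply,
      bsm_eq_kronecker γ A (fun α β => dim α β A) din (fun α β s => dim_eq_kronecker α β A s) p, kron_neg, Matrix.kronecker_smul]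
  · simp only [rmm, rmn, Sum.elim_inl, Sum.elim_inr,
      bsm_eq_kronecker γ A (fun α β => trm α β A) trn (fun α β s => trm_eq_kronecker α β A s) p]
  · simp only [rmm, rmn, Sum.elim_inr, Pi.neg_apply,
      bsm_eq_kronecker γ A (fun α β => fam α β A) fan (fun α β s => fam_eq_kronecker α β A s) p, kron_neg]

/-- **THE WILSON FIRST-ORDER VERTEX HAS ONE COLOUR WORD**: every colour block of `wm γ A` is `A ⊗ (colourless block)`,
`wm γ A = fun s ↦ A ⊗ₖ wn γ s`. [folklore] -/
theorem wm_eq_kronecker (γ : D) (A : Matrix C C ℝ) : wm γ A = fun s => A ⊗ₖ wn γ s := by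
  funext s
  rcases s with ((b | s) | p) | i
  · simpa only [wm, wn, Sum.elim_inl] using curM_copies_eq_kronecker (D := D) A b
  · simpa only [wm, wn, Sum.elim_inl, Sum.elim_inr] using spM_eq_kronecker γ A s
  · simpa only [wm, wn, Sum.elim_inl, Sum.elim_inr] using dvm_eq_kronecker γ A p
  · simpa only [wm, wn, Sum.elim_inr] using rmm_eq_kronecker γ A i

end Colourless

/-! ## §3 The colourless Wilson stencil; the vertex entrywise; the `C := Unit, A := 1` reading is exact -/

section Stencil

variable {Λ : Type*} [DecidableEq Λ] [AddCommGroup Λ] {C : Type*} {D : Type*} [Fintype D] [DecidableEq D]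

/-- **THE COLOURLESS WILSON STENCIL** of the background bond `(z, γ)` on `Λ × D`: the same offsets as `wilsonVertex₁`, the colourless
blocks `wn γ`.  A definition asserting nothing. [folklore] -/
noncomputable def wilsonStencil₀ (e : D → Λ) (z : Λ) (γ : D) : Matrix (Λ × D) (Λ × D) ℝ :=
  stencilIns z univ (wα e γ) (wβ e γ) (wn γ)

/-- **THE WILSON VERTEX IS THE KRONECKER STENCIL** `Σ_s E_{z+wα s, z+wβ s} ⊗ (A ⊗ wn γ s)`. [folklore] -/
theorem wilsonVertex₁_eq_kronStencil (e : D → Λ) (z : Λ) (γ : D) (A : Matrix C C ℝ) :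
    wilsonVertex₁ e z γ A = stencilIns z univ (wα e γ) (wβ e γ) (fun s => A ⊗ₖ wn γ s) := by
  rw [wilsonVertex₁_eq_stencil, wm_eq_kronecker]

/-- **ENTRYWISE: `wilsonVertex₁ e z γ A (x,(a,α)) (y,(b,β)) = A a b · wilsonStencil₀ e z γ (x,α) (y,β)`.** [folklore] -/
theorem wilsonVertex₁_apply_eq_mul (e : D → Λ) (z : Λ) (γ : D) (A : Matrix C C ℝ) (x y : Λ) (a b : C) (α β : D) :
    wilsonVertex₁ e z γ A (x, (a, α)) (y, (b, β)) = A a b * wilsonStencil₀ e z γ (x, α) (y, β) := by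
  rw [wilsonVertex₁_eq_kronStencil, wilsonStencil₀, stencilIns_apply, stencilIns_apply, Finset.mul_sum]
  refine Finset.sum_congr rfl fun s _ => ?_
  simp only [Matrix.kronecker_apply, mul_ite, mul_zero]

/-- **THE `C := Unit, A := 1` READING IS THE COLOURLESS STENCIL**: `wilsonStencil₀ e z γ (x,α) (y,β) = wilsonVertex₁ e z γ (1 : Matrix Unit
Unit ℝ) (x,((),α)) (y,((),β))` — the reading an2's `StepJetData.wEntry` takes (there on `ℤ^{d+1}` with `e := unitVec`). [folklore] -/
theorem wilsonStencil₀_apply_eq_unit (e : D → Λ) (z : Λ) (γ : D) (x y : Λ) (α β : D) :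
    wilsonStencil₀ e z γ (x, α) (y, β) = wilsonVertex₁ (C := Unit) e z γ (1 : Matrix Unit Unit ℝ) (x, ((), α)) (y, ((), β)) := by
  rw [wilsonVertex₁_apply_eq_mul, Matrix.one_apply_eq, one_mul]

/-- **AT FIRST ORDER THE `A := 1` COLOUR STRIPPING LOSES NOTHING**:
`wilsonVertex₁ e z γ A (x,(a,α)) (y,(b,β)) = A a b · wilsonVertex₁ e z γ 1 (x,((),α)) (y,((),β))`. [folklore] -/
theorem wilsonVertex₁_apply_eq_mul_unit (e : D → Λ) (z : Λ) (γ : D) (A : Matrix C C ℝ) (x y : Λ) (a b : C) (α β : D) :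
    wilsonVertex₁ e z γ A (x, (a, α)) (y, (b, β)) =
      A a b * wilsonVertex₁ (C := Unit) e z γ (1 : Matrix Unit Unit ℝ) (x, ((), α)) (y, ((), β)) := by
  rw [wilsonVertex₁_apply_eq_mul, wilsonStencil₀_apply_eq_unit]

end Stencil

/-! ## §4 Colour-blind contractions: the bubble carries `trace (A·A′)`, the tadpole `trace A` -/

section Contract

variable {Λ : Type*} [Fintype Λ] [DecidableEq Λ] [AddCommGroup Λ] {C : Type*} [Fintype C] [DecidableEq C]
  {D : Type*} [Fintype D] [DecidableEq D]

/-- **THE COLOUR-BLIND WILSON BUBBLE FACTORISES**: against translation-invariant colour-blind matrix-valued legs `1_C ⊗ G`, `1_C ⊗ G′`,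
`trace (K·V(z,γ;A)·K′·V(z+w,γ′;A′)) = trace (A·A′) · (the bubble of the COLOURLESS stencils with legs G, G′)`. [folklore] -/
theorem wilsonBubble_colourBlind (G G' : Λ → Matrix D D ℝ) (e : D → Λ) (z w : Λ) (γ γ' : D) (A A' : Matrix C C ℝ) :
    Matrix.trace (mconvKernel (cbLeg G) * wilsonVertex₁ e z γ A * (mconvKernel (cbLeg G') * wilsonVertex₁ e (z + w) γ' A')) =
      Matrix.trace (A * A') *
        Matrix.trace (mconvKernel G * wilsonStencil₀ e z γ * (mconvKernel G' * wilsonStencil₀ e (z + w) γ')) := by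
  rw [wilsonVertex₁_eq_kronStencil, wilsonVertex₁_eq_kronStencil, wilsonStencil₀, wilsonStencil₀, bubble_stencil_eq_table_m,
    bubble_stencil_eq_table_m, Finset.mul_sum]
  refine Finset.sum_congr rfl fun p _ => ?_
  rw [cbLeg_eq_kronecker, cbLeg_eq_kronecker, trace_kronLeg_mul_kronLeg_mul]

/-- … AS A FINITE TABLE over the pairs of Wilson stencil points (`BubbleTable.bubble_stencil_eq_table_m` on the colourless data): legs at
`wα − wβ′ − w` and `w + wα′ − wβ`, nothing depends on `z`. [folklore] -/
theorem wilsonBubble_colourBlind_table (G G' : Λ → Matrix D D ℝ) (e : D → Λ) (z w : Λ) (γ γ' : D) (A A' : Matrix C C ℝ) :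
    Matrix.trace (mconvKernel (cbLeg G) * wilsonVertex₁ e z γ A * (mconvKernel (cbLeg G') * wilsonVertex₁ e (z + w) γ' A')) =
      Matrix.trace (A * A') * ∑ p : WilsonIdx D × WilsonIdx D,
        Matrix.trace (G (wα e γ p.1 - wβ e γ' p.2 - w) * wn γ p.1 * (G' (w + wα e γ' p.2 - wβ e γ p.1) * wn γ' p.2)) := by
  rw [wilsonBubble_colourBlind, wilsonStencil₀, wilsonStencil₀, bubble_stencil_eq_table_m, Finset.univ_product_univ]

omit [Fintype C] [DecidableEq C] in
/-- the colourless bubble does not see the base point (only the offset `w`). [folklore] -/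
theorem wilsonBubble₀_translate (G G' : Λ → Matrix D D ℝ) (e : D → Λ) (z₁ z₂ w : Λ) (γ γ' : D) :
    Matrix.trace (mconvKernel G * wilsonStencil₀ e z₁ γ * (mconvKernel G' * wilsonStencil₀ e (z₁ + w) γ')) =
      Matrix.trace (mconvKernel G * wilsonStencil₀ e z₂ γ * (mconvKernel G' * wilsonStencil₀ e (z₂ + w) γ')) := by
  simp only [wilsonStencil₀, bubble_stencil_eq_table_m]

/-- **THE COLOUR-BLIND WILSON TADPOLE FACTORISES**: `trace (K·V(z,γ;A)) = trace A · (the contact term of the colourless stencil)`.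
[folklore] -/
theorem wilsonTadpole_colourBlind (G : Λ → Matrix D D ℝ) (e : D → Λ) (z : Λ) (γ : D) (A : Matrix C C ℝ) :
    Matrix.trace (mconvKernel (cbLeg G) * wilsonVertex₁ e z γ A) = Matrix.trace A * Matrix.trace (mconvKernel G * wilsonStencil₀ e z γ) := by
  rw [wilsonVertex₁_eq_kronStencil, wilsonStencil₀, contact_stencil_m, contact_stencil_m, Finset.mul_sum]
  refine Finset.sum_congr rfl fun s _ => ?_
  rw [cbLeg_eq_kronecker, trace_kronLeg_mul]

/-- … AS A FINITE TABLE: legs at the bounded offsets `wα s − wβ s` only. [folklore] -/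
theorem wilsonTadpole_colourBlind_table (G : Λ → Matrix D D ℝ) (e : D → Λ) (z : Λ) (γ : D) (A : Matrix C C ℝ) :
    Matrix.trace (mconvKernel (cbLeg G) * wilsonVertex₁ e z γ A) =
      Matrix.trace A * ∑ s : WilsonIdx D, Matrix.trace (G (wα e γ s - wβ e γ s) * wn γ s) := by
  rw [wilsonTadpole_colourBlind, wilsonStencil₀, contact_stencil_m]

/-- **A TRACELESS COLOUR MATRIX HAS NO COLOUR-BLIND TADPOLE**. [folklore] -/
theorem wilsonTadpole_colourBlind_eq_zero (G : Λ → Matrix D D ℝ) (e : D → Λ) (z : Λ) (γ : D) {A : Matrix C C ℝ}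
    (hA : Matrix.trace A = 0) : Matrix.trace (mconvKernel (cbLeg G) * wilsonVertex₁ e z γ A) = 0 := by
  rw [wilsonTadpole_colourBlind, hA, zero_mul]

omit [DecidableEq C] in
/-- an antisymmetric real matrix is traceless. [folklore] -/
theorem trace_eq_zero_of_antisymm {A : Matrix C C ℝ} (hA : ∀ a b, A b a = -A a b) : Matrix.trace A = 0 := by
  have h : ∀ a, A a a = 0 := fun a => by have := hA a a; linarith
  simp only [Matrix.trace, Matrix.diag_apply, h, Finset.sum_const_zero]

omit [DecidableEq C] in
/-- `adM τ t F` (antisymmetric, `PlaquetteVertex.adM_antisymm`) is traceless. [folklore] -/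
theorem trace_adM {𝔸 : Type*} [Ring 𝔸] [Algebra ℝ 𝔸] (τ : 𝔸 →ₗ[ℝ] ℝ) (t : C → 𝔸) (F : 𝔸) : Matrix.trace (adM τ t F) = 0 :=
  trace_eq_zero_of_antisymm (adM_antisymm τ t F)

/-- **THE WILSON VERTEX AT A COLOUR MATRIX `adM τ t F` HAS NO COLOUR-BLIND TADPOLE** (any algebra, functional, letters). [folklore] -/
theorem wilsonTadpole_adM {𝔸 : Type*} [Ring 𝔸] [Algebra ℝ 𝔸] (τ : 𝔸 →ₗ[ℝ] ℝ) (t : C → 𝔸) (F : 𝔸) (G : Λ → Matrix D D ℝ)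
    (e : D → Λ) (z : Λ) (γ : D) : Matrix.trace (mconvKernel (cbLeg G) * wilsonVertex₁ e z γ (adM τ t F)) = 0 :=
  wilsonTadpole_colourBlind_eq_zero G e z γ (trace_adM τ t F)

/-- **IN BAŁABAN'S LETTERS** (`Mat_N(ℂ)`, `rntr`, `gen τ c = I•τ c`; a complete tr-orthonormal Hermitian family, `N ≠ 0`): the colour-blind
Wilson bubble between the background letters `gen τ c` at `(z,γ)` and `gen τ c′` at `(z+w,γ′)` is `[c = c′]·(−2N²)` times the colourless
bubble — the one real weight is `ColourTrace.trace_adMat_gen` BY NAME (`adM rntr (gen τ) (gen τ c) = adMat τ (τ c)`, `PlaquetteVertex.adM_gen`).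
[folklore] -/
theorem wilsonBubble_gen {N : ℕ} {τ : C → Matrix (Fin N) (Fin N) ℂ} (hτ : Complete τ) (ho : TrOrthonormal τ)
    (hH : ∀ c, (τ c).IsHermitian) (hN : N ≠ 0) (G G' : Λ → Matrix D D ℝ) (e : D → Λ) (z w : Λ) (γ γ' : D) (c c' : C) :
    Matrix.trace (mconvKernel (cbLeg G) * wilsonVertex₁ e z γ (adM rntr (gen τ) (gen τ c)) *
        (mconvKernel (cbLeg G') * wilsonVertex₁ e (z + w) γ' (adM rntr (gen τ) (gen τ c')))) =
      (if c = c' then -(2 * (N : ℝ) ^ 2) else 0) *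
        Matrix.trace (mconvKernel G * wilsonStencil₀ e z γ * (mconvKernel G' * wilsonStencil₀ e (z + w) γ')) := by
  rw [wilsonBubble_colourBlind, adM_gen, adM_gen, trace_adMat_gen hτ ho hH hN]

end Contract

/-! ## §5 Examples -/

section Examples

variable {D : Type*} [DecidableEq D]

/-- the forward copy of the current carries the identity in direction space. [folklore] -/
example (γ : D) : wn γ (Sum.inl (Sum.inl (Sum.inl true))) = (1 : Matrix D D ℝ) := by
  simp [wn, curN]

/-- the first transport block of the remainder's colourless data is `e_{αβ}`. [folklore] -/
example (α β : D) : trn α β 0 = Matrix.single α β (1 : ℝ) := by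
  simp [trn]

end Examples

end Literature.MathematicalPhysics.QuantumFieldTheory.Balaban1983to89.Beta.WilsonVertexKron
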